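import Summits.QuantumFields.YangMills.Theorems.BalabanUVNodesPortU8GaugeRow
import Summits.QuantumFields.YangMills.Theorems.BalabanUVNodesPortU8DecayConversion

/-!
# PORT PT-B (U8), g2 file 5b — ROW (R1ᴰ) AT ONE (volume, domain, label), GENERIC IN THE RESPONSE VECTOR, CLAUSES ONLY ON THE BONDS OF `X` (v10-Loc's guarded token): the gauge packaging of file 8 (`rowR1D_at_of_entryDecay`) re-issued for ANY
# coordinate vector `g` whose `𝐔`-block chart matrices on the bonds of `X` are the entry matrices `Matrix.of (D b)` of a bond function `D` obeying (190)'s three scaled clauses, and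
# whose `𝐉`-block obeys the constant-radius bound — so the rooted response `recordGkJ … a y` (via ✓`chartMatU_cutTo_recordGkJ_entries`) and RC-2's Landau response `recordGkL … a y`
# (via file 4's `chartMatU_cutTo_fderiv_iota_entries` at the ed.14 chart) are both ONE-LINE instances — `--supports stmt-QuantumFields-27931` (helper; NOT a closer)

Cell `ym-nodeO-ideate` ∕ `ym-balaban-port`, porter `ymgap-nodeO-port-PTB-1` (gen 2), item **stmt-QuantumFields-27931** `BalabanUVNodes.PortPieceLocalityU8`.
[I] = [Balaban1987RG1], [15] = [Balaban1985Variational].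
WHAT IS PROVED (0 `sorry`, 0 `def`; standard axioms): ★★★ `gauge_recordDom44J_cutTo_le_of_entryDecayOn` — as ✓p800724's `…_of_entryDecay` but the three clauses are asked ONLY on `b ∈ domBonds X` (27931 v10-Loc's TokP9L4-Loc token is guarded by `coarsenTo (k+1) b.src ∈ recordWindow R3 z₀`, which (R1ᴰ-Loc)'s inner guard grants exactly on the bonds of `X`) — on the tiled range (`McGuard`, `recordK₀ ≤ K`), for any `g` and `D` with
`chartMatU (cutTo (recordCXJ X) g) b = Matrix.of (D b)` on `b ∈ X`, the three clauses `‖D b‖ ≤ Cη·e_b`, `‖D(b+e_ν) − D b‖ ≤ Cη²·e_b`, `‖Σ_ν(D(b+e_ν) − 2D b + D(b−e_ν))‖ ≤ Cη³·e_b`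
(`e_b = e^{−δ₉·tdist(coarsen b₋, y₀)}`) and `‖chartMatJc (cutTo … g) b‖ ≤ C_J·e_b` on `X` give `gauge (recordDom44J … X α₂) (cutTo … g) ≤ 2(2C + C_J + 1)e^{4δ₉Mc}∕α₂ · e^{−δ₉·dist(y,X)}`.
Proof = file 8's, with the three name-level conversions replaced by the hypothesis `hU` and `‖Matrix.of v‖ ≤ 2‖v‖`.
HONEST FRAMING.  Bookkeeping over an abstract response vector; nothing of Bałaban asserted; 27931 OPEN (CLOSE HOLD, Q-12); K0⁷ NOT closed; NODE O 0∕1; COUNT 8∕28 · K 1∕4 UNMOVED;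
finite `𝕋⁴_{L^K}` at fixed ε — NOT continuum ∕ OS ∕ Clay; **the Yang–Mills mass gap (Clay) is NOT proved.**
-/

noncomputable section

open scoped BigOperators Matrix.Norms.L2Operator

namespace Summit.QuantumFields.YangMills.Theorems.PortU8

open Literature.MathematicalPhysics.QuantumFieldTheory.Balaban1983to89
open Literature.MathematicalPhysics.QuantumFieldTheory.Balaban1983to89.Node00
open Literature.MathematicalPhysics.QuantumFieldTheory.Balaban1983to89.T4Continuum (T4Family)
open Summit.QuantumFields.YangMills.Theorems.K0RecordFormatNames

variable (F : T4Family)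

/-- ★★★ **ROW (R1ᴰ) AT ONE VOLUME∕DOMAIN∕LABEL — GENERIC IN THE RESPONSE VECTOR.**  See the file header; constants `C₉ = 2(2C + C_J + 1)e^{4δ₉Mc}∕α₂` uniform in `k, K, X, y`.
[cite: Balaban1987RG1, (4.4)–(4.5) pp.281–282; Balaban1985Variational, (190) p.308] -/
theorem gauge_recordDom44J_cutTo_le_of_entryDecayOn {Mc k K : ℕ} (hMc : McGuard F Mc) (hK : recordK₀ F Mc k ≤ K)
    (X : (recordDomSys F Mc k K).Dom) (y : RespLabel F k K) (g : Fin (recordChartDimJ F K) → ℂ) (D : PBond (F.P K) 0 → Fin 2 → Fin 2 → ℂ)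
    {α₂ C CJ δ₉ : ℝ} (hα : 0 < α₂) (hC : 0 ≤ C) (hCJ : 0 ≤ CJ) (hδ : 0 ≤ δ₉)
    (hU : ∀ b ∈ domBonds F Mc k K X, chartMatU F K (B12FormatPlus.cutTo (recordCXJ F Mc k K X) g) b = Matrix.of (D b))
    (hdec : ∀ b ∈ domBonds F Mc k K X,
        ‖D b‖ ≤ C * (F.P K).eta (k + 1) * Real.exp (-(δ₉ * (Site.tdist (coarsenTo (k + 1) b.src) y.2 : ℝ))) ∧
        (∀ ν : Fin (F.P K).d, ‖D ⟨b.src.shift ν, b.dir⟩ - D b‖ ≤ C * (F.P K).eta (k + 1) ^ 2 * Real.exp (-(δ₉ * (Site.tdist (coarsenTo (k + 1) b.src) y.2 : ℝ)))) ∧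
        ‖∑ ν : Fin (F.P K).d, (D ⟨b.src.shift ν, b.dir⟩ - (2 : ℂ) • D b + D ⟨b.src.unshift ν, b.dir⟩)‖ ≤
          C * (F.P K).eta (k + 1) ^ 3 * Real.exp (-(δ₉ * (Site.tdist (coarsenTo (k + 1) b.src) y.2 : ℝ))))
    (hJ : ∀ b ∈ domBonds F Mc k K X, ‖chartMatJc F K (B12FormatPlus.cutTo (recordCXJ F Mc k K X) g) b‖ ≤
        CJ * Real.exp (-(δ₉ * (Site.tdist (coarsenTo (k + 1) b.src) y.2 : ℝ)))) :
    gauge (recordDom44J F Mc k K X α₂) (B12FormatPlus.cutTo (recordCXJ F Mc k K X) g) ≤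
      2 * (2 * C + CJ + 1) * Real.exp (4 * δ₉ * Mc) / α₂ * Real.exp (-δ₉ * (recordSiteGeom F Mc k K).distD y X) := by
  set η := (F.P K).eta (k + 1) with hη
  have hη0 : 0 < η := by
    rw [hη]; unfold Params.eta
    exact pow_pos (inv_pos.2 (F.P K).cast_L_pos) _
  set Ed := Real.exp (-δ₉ * (recordSiteGeom F Mc k K).distD y X) with hEd
  set A := 2 * (2 * C + CJ + 1) * Real.exp (4 * δ₉ * Mc) / α₂ with hA
  have hS : 0 < 2 * C + CJ + 1 := by linarith
  have hA0 : 0 < A := by rw [hA]; positivity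
  have ht : 0 < A * Ed := mul_pos hA0 (Real.exp_pos _)
  have hconv : ∀ b ∈ domBonds F Mc k K X,
      Real.exp (-(δ₉ * (Site.tdist (coarsenTo (k + 1) b.src) y.2 : ℝ))) ≤ Real.exp (4 * δ₉ * Mc) * Ed := fun b hb =>
    exp_neg_tdist_le hδ (distD_le_tdist_add hMc hK X hb y)
  set w := B12FormatPlus.cutTo (recordCXJ F Mc k K X) g with hw
  refine gauge_recordDom44J_le F X α₂ ht w ?_
  set r : ℝ := (A * Ed)⁻¹ with hr
  have hr0 : 0 ≤ r := inv_nonneg.2 ht.le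
  have hratio : r * (Real.exp (4 * δ₉ * Mc) * Ed) = α₂ / (2 * (2 * C + CJ + 1)) := by
    rw [hr, hA]
    have hE : Ed ≠ 0 := (Real.exp_pos _).ne'
    have hX : Real.exp (4 * δ₉ * Mc) ≠ 0 := (Real.exp_pos _).ne'
    field_simp
  have hnorm_smul : ∀ M : MatA 2, ‖(r : ℂ) • M‖ = r * ‖M‖ := fun M => by
    rw [norm_smul, Complex.norm_real, Real.norm_of_nonneg hr0]
  have step : ∀ {q c rad : ℝ} {b : PBond (F.P K) 0}, b ∈ domBonds F Mc k K X → 0 ≤ c →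
      q ≤ c * Real.exp (-(δ₉ * (Site.tdist (coarsenTo (k + 1) b.src) y.2 : ℝ))) → c * (α₂ / (2 * (2 * C + CJ + 1))) < rad →
      r * q < rad := by
    intro q c rad b hb hc hq hlt
    have h1 : r * q ≤ r * (c * (Real.exp (4 * δ₉ * Mc) * Ed)) :=
      mul_le_mul_of_nonneg_left (hq.trans (mul_le_mul_of_nonneg_left (hconv b hb) hc)) hr0
    have h2 : r * (c * (Real.exp (4 * δ₉ * Mc) * Ed)) = c * (α₂ / (2 * (2 * C + CJ + 1))) := by
      rw [← hratio]; ring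
    linarith
  have hq1 : C * (α₂ / (2 * (2 * C + CJ + 1))) * 2 < α₂ := by
    rw [show C * (α₂ / (2 * (2 * C + CJ + 1))) * 2 = α₂ * (C / (2 * C + CJ + 1)) by field_simp]
    have : C / (2 * C + CJ + 1) < 1 := by rw [div_lt_one hS]; linarith
    nlinarith
  have hqJ : CJ * (α₂ / (2 * (2 * C + CJ + 1))) < α₂ := by
    rw [show CJ * (α₂ / (2 * (2 * C + CJ + 1))) = α₂ * (CJ / (2 * (2 * C + CJ + 1))) by field_simp]
    have : CJ / (2 * (2 * C + CJ + 1)) < 1 := by rw [div_lt_one (by linarith)]; linarith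
    nlinarith
  -- the entry bridge: `Matrix.of` as a real CLM, for differences and sums
  obtain ⟨e, he⟩ := exists_ofCLM
  have hUe : ∀ b ∈ domBonds F Mc k K X, chartMatU F K w b = e (D b) := fun b hb => by rw [hw, hU b hb, he]
  refine ⟨fun b hb => ?_, fun b hb ν hν => ?_, fun b hb hall => ?_, fun b hb => ?_⟩
  · -- value clause
    rw [chartMatU_real_smul, hnorm_smul]
    have hb1 : ‖chartMatU F K w b‖ ≤ 2 * (C * η * Real.exp (-(δ₉ * (Site.tdist (coarsenTo (k + 1) b.src) y.2 : ℝ)))) := by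
      rw [hU b hb]; exact (norm_of_le_two_mul_norm _).trans (mul_le_mul_of_nonneg_left (hdec b hb).1 zero_le_two)
    exact step hb (by positivity : 0 ≤ 2 * (C * η)) (by nlinarith [hb1, Real.exp_pos (-(δ₉ * (Site.tdist (coarsenTo (k + 1) b.src) y.2 : ℝ)))])
      (show 2 * (C * η) * (α₂ / (2 * (2 * C + CJ + 1))) < α₂ * η by nlinarith [hq1, hη0])
  · -- first-difference clause
    rw [chartMatU_real_smul, chartMatU_real_smul, ← smul_sub, hnorm_smul]
    have hb1 : ‖chartMatU F K w ⟨b.src.shift ν, b.dir⟩ - chartMatU F K w b‖ ≤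
        2 * (C * η ^ 2 * Real.exp (-(δ₉ * (Site.tdist (coarsenTo (k + 1) b.src) y.2 : ℝ)))) := by
      rw [hUe _ hν, hUe b hb, ← map_sub, he]
      exact (norm_of_le_two_mul_norm _).trans (mul_le_mul_of_nonneg_left ((hdec b hb).2.1 ν) zero_le_two)
    exact step hb (by positivity : 0 ≤ 2 * (C * η ^ 2)) (by nlinarith [hb1, Real.exp_pos (-(δ₉ * (Site.tdist (coarsenTo (k + 1) b.src) y.2 : ℝ)))])
      (show 2 * (C * η ^ 2) * (α₂ / (2 * (2 * C + CJ + 1))) < α₂ * η ^ 2 by nlinarith [hq1, pow_pos hη0 2])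
  · -- Laplacian clause
    have hre : ∑ ν : Fin (F.P K).d, (chartMatU F K (r • w) ⟨b.src.shift ν, b.dir⟩ - (2 : ℂ) • chartMatU F K (r • w) b +
        chartMatU F K (r • w) ⟨b.src.unshift ν, b.dir⟩) =
        (r : ℂ) • ∑ ν : Fin (F.P K).d, (chartMatU F K w ⟨b.src.shift ν, b.dir⟩ - (2 : ℂ) • chartMatU F K w b + chartMatU F K w ⟨b.src.unshift ν, b.dir⟩) := by
      rw [Finset.smul_sum]
      refine Finset.sum_congr rfl fun ν _ => ?_
      rw [chartMatU_real_smul, chartMatU_real_smul, chartMatU_real_smul, smul_add, smul_sub, smul_comm (r : ℂ) (2 : ℂ)]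
    rw [hre, hnorm_smul]
    have hsum : ∑ ν : Fin (F.P K).d, (chartMatU F K w ⟨b.src.shift ν, b.dir⟩ - (2 : ℂ) • chartMatU F K w b + chartMatU F K w ⟨b.src.unshift ν, b.dir⟩) =
        e (∑ ν : Fin (F.P K).d, (D ⟨b.src.shift ν, b.dir⟩ - (2 : ℂ) • D b + D ⟨b.src.unshift ν, b.dir⟩)) := by
      rw [map_sum]
      refine Finset.sum_congr rfl fun ν _ => ?_
      have h2 : e ((2 : ℂ) • D b) = (2 : ℂ) • e (D b) := by
        rw [show ((2 : ℂ) • D b) = (2 : ℝ) • D b by rw [← Complex.coe_smul]; norm_num, map_smul, ← Complex.coe_smul]; norm_num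
      rw [hUe _ (hall ν).1, hUe b hb, hUe _ (hall ν).2, map_add, map_sub, h2]
    have hb1 : ‖∑ ν : Fin (F.P K).d, (chartMatU F K w ⟨b.src.shift ν, b.dir⟩ - (2 : ℂ) • chartMatU F K w b + chartMatU F K w ⟨b.src.unshift ν, b.dir⟩)‖ ≤
        2 * (C * η ^ 3 * Real.exp (-(δ₉ * (Site.tdist (coarsenTo (k + 1) b.src) y.2 : ℝ)))) := by
      rw [hsum, he]
      exact (norm_of_le_two_mul_norm _).trans (mul_le_mul_of_nonneg_left (hdec b hb).2.2 zero_le_two)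
    exact step hb (by positivity : 0 ≤ 2 * (C * η ^ 3)) (by nlinarith [hb1, Real.exp_pos (-(δ₉ * (Site.tdist (coarsenTo (k + 1) b.src) y.2 : ℝ)))])
      (show 2 * (C * η ^ 3) * (α₂ / (2 * (2 * C + CJ + 1))) < α₂ * η ^ 3 by nlinarith [hq1, pow_pos hη0 3])
  · -- 𝐉-block clause
    rw [chartMatJc_real_smul, hnorm_smul]
    exact step hb hCJ (hJ b hb) hqJ

end Summit.QuantumFields.YangMills.Theorems.PortU8

end
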